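import Summits.CriticalPhenomena.PercolationContinuityZ3.Theorems.PercNearOneGluingNoHeavyLowerTailFourPointAtoms
import Summits.CriticalPhenomena.PercolationContinuityZ3.Theorems.PercNearOneGluingNoHeavyLowerTailCovTrianglePathCells
import Summits.CriticalPhenomena.PercolationContinuityZ3.Theorems.PercNearOneGluingNoHeavyLowerTailFourPointAtomsStep
import Summits.CriticalPhenomena.PercolationContinuityZ3.Theorems.PercNearOneGluingNoHeavyLowerTailL1CertDict
import Summits.CriticalPhenomena.PercolationContinuityZ3.Theorems.PercNearOneGluingNoHeavyLowerTailSwitchRelaxE1inc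
import Summits.CriticalPhenomena.PercolationContinuityZ3.Theorems.PercNearOneGluingNoHeavyLowerTailSwitchRelaxFinc24Measure
import Summits.CriticalPhenomena.PercolationContinuityZ3.Theorems.PercNearOneGluingNoHeavyLowerTailSwitchRelaxGR3Measure
import Summits.CriticalPhenomena.PercolationContinuityZ3.Theorems.PercNearOneGluingNoHeavyLowerTailSwitchRelaxIncDictionary
import Summits.CriticalPhenomena.PercolationContinuityZ3.Theorems.PercNearOneGluingNoHeavyLowerTailSwitchRelaxIncDictionary2
import Literature.Probability.Percolation.TwoSetExchange
import Literature.Probability.Percolation.StrongHarrisThreePoint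
import Literature.Probability.Percolation.PercolationEvents
import Literature.Probability.LatticeModels.ProdBernoulliIndependence
import HarnessLib

/-!
# `NoHeavyLowerTail` (stmt-CriticalPhenomena-4575) — the covariance triangle CT (PATH instance) and the cubic decoupling
# inequality R2 on every finite weighted graph

Support file (prover prim-facecert gen 10, certificate lane; `--supports stmt-CriticalPhenomena-4575`).  No definitions, no named
facts, no sorries, standard axioms.  The measure-level transfer of `CovTrianglePath.r2_cells_nonneg` / `ct_cells_nonneg`
(`…CovTrianglePathCells`): the fifteen variables are the four-point cells `FourPointAtoms.cell w a b c y i` of `μ = prodBernoulli w`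
(prim-bnk-1's dictionary `…FourPointAtoms`, `measureReal_eq_cellSum`), and every row hypothesis is an instance of a tree theorem
moved to cells by the atom decomposition (`decide` on the 15 patterns; cell-sum lemmas already in the tree — prim-bnk-1's
`FourPointAtoms.real_*`, prim-l12-p1's `SwitchRelax.*` dictionaries — are reused, the others are proved here): Harris for decreasing / increasing connection events
(`prodBernoulli_harris_lower`, `prodBernoulli_harris`), the van den Berg–Häggström–Kahn two-set exchange inequality
`setTwoClusterExchange` (three instances with `S = {a}`), and Aas–Gladkov's three-point inequality
`prodBernoulli_threePoint_strongHarris` on `(a,b,c)` and `(a,b,y)`.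
RESULTS: `r2_path` — `P(a≁b)²·P(a~b, a≁c, b≁y) ≤ P(a~b)·P(a≁b,a≁c)·P(a≁b,b≁y)` (new cubic four-point inequality "conditional
decoupling across the pivot pair"); **`covTriangle_path`** — prim-ineq-prove-3's covariance triangle (INEQ-CLAIMS row CT), PATH
instance, for every finite weighted graph: `P(a≁b)²·Cov(a~c,b~y) ≤ P(a≁b,b≁y)·Cov(a~b,a~c) + P(a≁b,a≁c)·Cov(a~b,b~y)`.
[this work] (sources: prim-facecert gen-10 certificate kit j144635 and decomposition; prim-bnk-1 dictionary)
-/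

noncomputable section

namespace Summit.CriticalPhenomena.PercolationContinuityZ3.Theorems

namespace CovTrianglePath

open MeasureTheory Set Literature.Probability.Percolation
open Literature.Probability.LatticeModels (prodBernoulli prodBernoulli_harris prodBernoulli_harris_lower)
open Summit.CriticalPhenomena.PercolationContinuityZ3.Cruxes.AdditiveGluing.TieLine.ConnAtoms
open FourPointAtoms

variable {V : Type*} [Fintype V] (w : Sym2 V → unitInterval) (a b c y : V)

omit [Fintype V] in
/-- The separation event of `setTwoClusterExchange` for singletons `S = {s}`, `T = {t}` is `{s ≁ t}`. [folklore] -/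
theorem dset_eq (s t : V) :
    {ω : BondConfig V | ∀ s' ∈ ({s} : Set V), ∀ t' ∈ ({t} : Set V), ¬ (openGraph ω).Reachable s' t'} = (openConn s t)ᶜ := by
  ext ω
  simp only [Set.mem_setOf_eq, Set.mem_singleton_iff, forall_eq, Set.mem_compl_iff, openConn]

/-! ### Dictionary: the events of the rows and of the two targets as sums of four-point cells -/

/-- `μ((openConn a b)ᶜ)` as a sum of four-point cells. [this work] -/
theorem real_Dab : (prodBernoulli w).real ((openConn a b)ᶜ) = cell w a b c y 0 + cell w a b c y 1 + cell w a b c y 2 + cell w a b c y 3 + cell w a b c y 4 + cell w a b c y 5 + cell w a b c y 7 + cell w a b c y 8 + cell w a b c y 9 + cell w a b c y 10 := by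
  rw [measureReal_eq_cellSum w a b c y (show HasPattern (quad a b c y) ((openConn a b)ᶜ) _ from (oc a b c y 0 1 rfl rfl).compl)]
  simp (config := {decide := true}) only [ite_true, ite_false]; ring

/-- `μ((openConn a c)ᶜ ∩ (openConn a y)ᶜ ∩ (openConn b c)ᶜ ∩ (openConn b y)ᶜ ∩ ((openConn a b)ᶜ ∩ (openConn a y)ᶜ))` as a sum of four-point cells. [this work] -/
theorem real_Dabcy_Daby : (prodBernoulli w).real ((openConn a c)ᶜ ∩ (openConn a y)ᶜ ∩ (openConn b c)ᶜ ∩ (openConn b y)ᶜ ∩ ((openConn a b)ᶜ ∩ (openConn a y)ᶜ)) = cell w a b c y 0 + cell w a b c y 1 := by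
  rw [measureReal_eq_cellSum w a b c y (show HasPattern (quad a b c y) ((openConn a c)ᶜ ∩ (openConn a y)ᶜ ∩ (openConn b c)ᶜ ∩ (openConn b y)ᶜ ∩ ((openConn a b)ᶜ ∩ (openConn a y)ᶜ)) _ from (((((oc a b c y 0 2 rfl rfl).compl.inter (oc a b c y 0 3 rfl rfl).compl).inter (oc a b c y 1 2 rfl rfl).compl).inter (oc a b c y 1 3 rfl rfl).compl).inter ((oc a b c y 0 1 rfl rfl).compl.inter (oc a b c y 0 3 rfl rfl).compl)))]
  simp (config := {decide := true}) only [ite_true, ite_false]; ring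

/-- `μ((openConn a c)ᶜ ∩ (openConn a y)ᶜ ∩ (openConn b c)ᶜ ∩ (openConn b y)ᶜ ∩ (openConn a b)ᶜ)` as a sum of four-point cells. [this work] -/
theorem real_Dabcy_Dab : (prodBernoulli w).real ((openConn a c)ᶜ ∩ (openConn a y)ᶜ ∩ (openConn b c)ᶜ ∩ (openConn b y)ᶜ ∩ (openConn a b)ᶜ) = cell w a b c y 0 + cell w a b c y 1 := by
  rw [measureReal_eq_cellSum w a b c y (show HasPattern (quad a b c y) ((openConn a c)ᶜ ∩ (openConn a y)ᶜ ∩ (openConn b c)ᶜ ∩ (openConn b y)ᶜ ∩ (openConn a b)ᶜ) _ from (((((oc a b c y 0 2 rfl rfl).compl.inter (oc a b c y 0 3 rfl rfl).compl).inter (oc a b c y 1 2 rfl rfl).compl).inter (oc a b c y 1 3 rfl rfl).compl).inter (oc a b c y 0 1 rfl rfl).compl))]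
  simp (config := {decide := true}) only [ite_true, ite_false]; ring

/-- `μ((openConn a y)ᶜ)` as a sum of four-point cells. [this work] -/
theorem real_Day : (prodBernoulli w).real ((openConn a y)ᶜ) = cell w a b c y 0 + cell w a b c y 1 + cell w a b c y 2 + cell w a b c y 3 + cell w a b c y 5 + cell w a b c y 6 + cell w a b c y 7 + cell w a b c y 9 + cell w a b c y 11 + cell w a b c y 13 := by
  rw [measureReal_eq_cellSum w a b c y (show HasPattern (quad a b c y) ((openConn a y)ᶜ) _ from (oc a b c y 0 3 rfl rfl).compl)]
  simp (config := {decide := true}) only [ite_true, ite_false]; ring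

/-- `μ((openConn a y)ᶜ ∩ openConn a b)` as a sum of four-point cells. [this work] -/
theorem real_Day_ab : (prodBernoulli w).real ((openConn a y)ᶜ ∩ openConn a b) = cell w a b c y 6 + cell w a b c y 11 + cell w a b c y 13 := by
  rw [measureReal_eq_cellSum w a b c y (show HasPattern (quad a b c y) ((openConn a y)ᶜ ∩ openConn a b) _ from ((oc a b c y 0 3 rfl rfl).compl.inter (oc a b c y 0 1 rfl rfl)))]
  simp (config := {decide := true}) only [ite_true, ite_false]; ring

/-- `μ((openConn a y)ᶜ ∩ openConn a c)` as a sum of four-point cells. [this work] -/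
theorem real_Day_ac : (prodBernoulli w).real ((openConn a y)ᶜ ∩ openConn a c) = cell w a b c y 5 + cell w a b c y 9 + cell w a b c y 13 := by
  rw [measureReal_eq_cellSum w a b c y (show HasPattern (quad a b c y) ((openConn a y)ᶜ ∩ openConn a c) _ from ((oc a b c y 0 3 rfl rfl).compl.inter (oc a b c y 0 2 rfl rfl)))]
  simp (config := {decide := true}) only [ite_true, ite_false]; ring

/-- `μ((openConn a y)ᶜ ∩ (openConn a b ∩ openConn a c))` as a sum of four-point cells. [this work] -/
theorem real_Day_abac : (prodBernoulli w).real ((openConn a y)ᶜ ∩ (openConn a b ∩ openConn a c)) = cell w a b c y 13 := by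
  rw [measureReal_eq_cellSum w a b c y (show HasPattern (quad a b c y) ((openConn a y)ᶜ ∩ (openConn a b ∩ openConn a c)) _ from ((oc a b c y 0 3 rfl rfl).compl.inter ((oc a b c y 0 1 rfl rfl).inter (oc a b c y 0 2 rfl rfl))))]
  simp (config := {decide := true}) only [ite_true, ite_false]; ring

/-- `μ((openConn a b)ᶜ ∩ openConn b y)` as a sum of four-point cells. [this work] -/
theorem real_Dab_by : (prodBernoulli w).real ((openConn a b)ᶜ ∩ openConn b y) = cell w a b c y 2 + cell w a b c y 7 + cell w a b c y 9 := by
  rw [measureReal_eq_cellSum w a b c y (show HasPattern (quad a b c y) ((openConn a b)ᶜ ∩ openConn b y) _ from ((oc a b c y 0 1 rfl rfl).compl.inter (oc a b c y 1 3 rfl rfl)))]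
  simp (config := {decide := true}) only [ite_true, ite_false]; ring

/-- `μ((openConn a b)ᶜ ∩ ((openConn a c)ᶜ ∩ openConn b y))` as a sum of four-point cells. [this work] -/
theorem real_Dab_nacby : (prodBernoulli w).real ((openConn a b)ᶜ ∩ ((openConn a c)ᶜ ∩ openConn b y)) = cell w a b c y 2 + cell w a b c y 7 := by
  rw [measureReal_eq_cellSum w a b c y (show HasPattern (quad a b c y) ((openConn a b)ᶜ ∩ ((openConn a c)ᶜ ∩ openConn b y)) _ from ((oc a b c y 0 1 rfl rfl).compl.inter ((oc a b c y 0 2 rfl rfl).compl.inter (oc a b c y 1 3 rfl rfl))))]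
  simp (config := {decide := true}) only [ite_true, ite_false]; ring

/-- `μ(openConn a b ∩ (openConn a c)ᶜ ∩ (openConn b y)ᶜ)` as a sum of four-point cells. [this work] -/
theorem real_R2m : (prodBernoulli w).real (openConn a b ∩ (openConn a c)ᶜ ∩ (openConn b y)ᶜ) = cell w a b c y 6 + cell w a b c y 11 := by
  rw [measureReal_eq_cellSum w a b c y (show HasPattern (quad a b c y) (openConn a b ∩ (openConn a c)ᶜ ∩ (openConn b y)ᶜ) _ from (((oc a b c y 0 1 rfl rfl).inter (oc a b c y 0 2 rfl rfl).compl).inter (oc a b c y 1 3 rfl rfl).compl))]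
  simp (config := {decide := true}) only [ite_true, ite_false]; ring

/-! ### The rows at the cells of `prodBernoulli w`, and the two theorems -/

omit [Fintype V] in
/-- Lower sets: `D[ab|cy]`. [folklore] -/
theorem isLowerSet_Dabcy : IsLowerSet ((openConn a c)ᶜ ∩ (openConn a y)ᶜ ∩ (openConn b c)ᶜ ∩ (openConn b y)ᶜ : Set (BondConfig V)) :=
  (((isUpperSet_openConn a c).compl.inter (isUpperSet_openConn a y).compl).inter (isUpperSet_openConn b c).compl).inter
    (isUpperSet_openConn b y).compl

/-- **R2 (conditional decoupling across the pivot pair; PATH instance) on every finite weighted graph**: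
`P(a≁b)²·P(a~b, a≁c, b≁y) ≤ P(a~b)·P(a≁b, a≁c)·P(a≁b, b≁y)`, i.e. `P(a≁c ∧ b≁y | a~b) ≤ P(a≁c | a≁b)·P(b≁y | a≁b)` for
`μ = prodBernoulli w` and any vertices `a b c y`.  From `r2_cells_nonneg` with the rows supplied by `prodBernoulli_harris_lower`,
`setTwoClusterExchange` (BHK) and `prodBernoulli_threePoint_strongHarris` (Aas–Gladkov). [this work] -/
theorem r2_path : (prodBernoulli w).real (openConn a b)ᶜ ^ 2 * (prodBernoulli w).real (openConn a b ∩ (openConn a c)ᶜ ∩ (openConn b y)ᶜ) ≤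
      (prodBernoulli w).real (openConn a b) * (prodBernoulli w).real ((openConn a b)ᶜ ∩ (openConn a c)ᶜ) *
        (prodBernoulli w).real ((openConn a b)ᶜ ∩ (openConn b y)ᶜ) := by
  have hDabcy := isLowerSet_Dabcy (V := V) a b c y
  have hDaby : IsLowerSet ((openConn a b)ᶜ ∩ (openConn a y)ᶜ : Set (BondConfig V)) := (isUpperSet_openConn a b).compl.inter (isUpperSet_openConn a y).compl
  have hDab : IsLowerSet ((openConn a b)ᶜ : Set (BondConfig V)) := (isUpperSet_openConn a b).compl
  have hH1 : 0 ≤ (cell w a b c y 0 + cell w a b c y 1) * 1 - (cell w a b c y 0 + cell w a b c y 1 + cell w a b c y 6 + cell w a b c y 11) * (cell w a b c y 0 + cell w a b c y 1 + cell w a b c y 2 + cell w a b c y 3 + cell w a b c y 5 + cell w a b c y 7 + cell w a b c y 9) := by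
    have h := prodBernoulli_harris_lower w hDabcy hDaby MeasurableSet.of_discrete MeasurableSet.of_discrete
    rw [SwitchRelax.GR3.rE1, FourPointAtoms.real_xDabDay, real_Dabcy_Daby] at h
    linarith [h]
  have hH2 : 0 ≤ (cell w a b c y 0 + cell w a b c y 1) * 1 - (cell w a b c y 0 + cell w a b c y 1 + cell w a b c y 6 + cell w a b c y 11) * (cell w a b c y 0 + cell w a b c y 1 + cell w a b c y 2 + cell w a b c y 3 + cell w a b c y 4 + cell w a b c y 5 + cell w a b c y 7 + cell w a b c y 8 + cell w a b c y 9 + cell w a b c y 10) := by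
    have h := prodBernoulli_harris_lower w hDabcy hDab MeasurableSet.of_discrete MeasurableSet.of_discrete
    rw [SwitchRelax.GR3.rE1, real_Dab, real_Dabcy_Dab] at h
    linarith [h]
  have hT1 : 0 ≤ cell w a b c y 13 * (cell w a b c y 0 + cell w a b c y 1 + cell w a b c y 2 + cell w a b c y 3 + cell w a b c y 5 + cell w a b c y 6 + cell w a b c y 7 + cell w a b c y 9 + cell w a b c y 11 + cell w a b c y 13) - (cell w a b c y 6 + cell w a b c y 11 + cell w a b c y 13) * (cell w a b c y 5 + cell w a b c y 9 + cell w a b c y 13) := by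
    have h := setTwoClusterExchange w ({a} : Set V) ({y} : Set V) (A₁ := openConn a b) (A₂ := openConn a c)
      (B₁ := Set.univ) (B₂ := Set.univ)
      (TwoSetExchange.typePlus_openConn_of_mem _ _ (Set.mem_singleton a) b)
      (TwoSetExchange.typePlus_openConn_of_mem _ _ (Set.mem_singleton a) c)
      (fun _ _ _ _ _ => Set.mem_univ _) (fun _ _ _ _ _ => Set.mem_univ _)
    rw [dset_eq] at h
    simp only [Set.inter_univ] at h
    rw [real_Day_ab, real_Day_ac, real_Day_abac, real_Day] at h
    linarith [h]
  have hT2 : 0 ≤ (cell w a b c y 2 + cell w a b c y 7) * (cell w a b c y 0 + cell w a b c y 1 + cell w a b c y 2 + cell w a b c y 3 + cell w a b c y 4 + cell w a b c y 5 + cell w a b c y 7 + cell w a b c y 8 + cell w a b c y 9 + cell w a b c y 10) - (cell w a b c y 0 + cell w a b c y 1 + cell w a b c y 2 + cell w a b c y 3 + cell w a b c y 4 + cell w a b c y 7 + cell w a b c y 8) * (cell w a b c y 2 + cell w a b c y 7 + cell w a b c y 9) := by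
    have h := setTwoClusterExchange w ({a} : Set V) ({b} : Set V) (A₁ := Set.univ) (A₂ := Set.univ)
      (B₁ := (openConn a c)ᶜ) (B₂ := openConn b y)
      (fun _ _ _ _ _ => Set.mem_univ _) (fun _ _ _ _ _ => Set.mem_univ _)
      (TwoSetExchange.typeMinus_not_openConn_of_mem _ _ (Set.mem_singleton a) c)
      (TwoSetExchange.typeMinus_openConn_of_mem _ _ (Set.mem_singleton b) y)
    rw [dset_eq] at h
    simp only [Set.univ_inter, Set.inter_univ] at h
    rw [FourPointAtoms.real_shk_AB, real_Dab_by, real_Dab, real_Dab_nacby] at h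
    linarith [h]
  have hAGabc : 0 ≤ (cell w a b c y 13 + cell w a b c y 14) * (cell w a b c y 0 + cell w a b c y 1 + cell w a b c y 2 + cell w a b c y 4) - (cell w a b c y 6 + cell w a b c y 11 + cell w a b c y 12) * (cell w a b c y 5 + cell w a b c y 9 + cell w a b c y 10) - (cell w a b c y 6 + cell w a b c y 11 + cell w a b c y 12) * (cell w a b c y 3 + cell w a b c y 7 + cell w a b c y 8) - (cell w a b c y 5 + cell w a b c y 9 + cell w a b c y 10) * (cell w a b c y 3 + cell w a b c y 7 + cell w a b c y 8) := by
    have h := prodBernoulli_threePoint_strongHarris w a b c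
    rw [FourPointAtoms.real_lu1, FourPointAtoms.real_lu2, FourPointAtoms.real_lu3, FourPointAtoms.real_lt, FourPointAtoms.real_shk_ABC] at h
    linarith [h]
  have hAGaby : 0 ≤ (cell w a b c y 12 + cell w a b c y 14) * (cell w a b c y 0 + cell w a b c y 1 + cell w a b c y 3 + cell w a b c y 5) - (cell w a b c y 6 + cell w a b c y 11 + cell w a b c y 13) * (cell w a b c y 4 + cell w a b c y 8 + cell w a b c y 10) - (cell w a b c y 6 + cell w a b c y 11 + cell w a b c y 13) * (cell w a b c y 2 + cell w a b c y 7 + cell w a b c y 9) - (cell w a b c y 4 + cell w a b c y 8 + cell w a b c y 10) * (cell w a b c y 2 + cell w a b c y 7 + cell w a b c y 9) := by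
    have h := prodBernoulli_threePoint_strongHarris w a b y
    rw [FourPointAtoms.real_xCabDay, FourPointAtoms.real_xCayDab, FourPointAtoms.real_xCbyDab, FourPointAtoms.real_xCabCay, FourPointAtoms.real_xDabDayDby] at h
    linarith [h]
  have key := r2_cells_nonneg (cell w a b c y 0) (cell w a b c y 1) (cell w a b c y 2) (cell w a b c y 3) (cell w a b c y 4) (cell w a b c y 5) (cell w a b c y 6) (cell w a b c y 7) (cell w a b c y 8) (cell w a b c y 9) (cell w a b c y 10) (cell w a b c y 11) (cell w a b c y 12) (cell w a b c y 13) (cell w a b c y 14)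
    (cell_nonneg w a b c y 0) (cell_nonneg w a b c y 1) (cell_nonneg w a b c y 2) (cell_nonneg w a b c y 3) (cell_nonneg w a b c y 4) (cell_nonneg w a b c y 5) (cell_nonneg w a b c y 6) (cell_nonneg w a b c y 7) (cell_nonneg w a b c y 8) (cell_nonneg w a b c y 9) (cell_nonneg w a b c y 10) (cell_nonneg w a b c y 11) (cell_nonneg w a b c y 12) (cell_nonneg w a b c y 13) (cell_nonneg w a b c y 14) (sum_cell_eq_one w a b c y) hH1 hH2 hT1 hT2 hAGabc hAGaby
  rw [real_Dab, real_R2m, SwitchRelax.Finc24.rE2, FourPointAtoms.real_shk_AB, FourPointAtoms.real_xDabDby]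
  linarith [key]

/-- **THE COVARIANCE TRIANGLE, PATH INSTANCE (prim-ineq-prove-3's row CT), on every finite weighted graph**: for
`μ = prodBernoulli w` and any vertices `a b c y`,
`μ(a≁b)²·(μ(a~c ∧ b~y) − μ(a~c)μ(b~y)) ≤ μ(a≁b ∧ b≁y)·(μ(a~b ∧ a~c) − μ(a~b)μ(a~c)) + μ(a≁b ∧ a≁c)·(μ(a~b ∧ b~y) − μ(a~b)μ(b~y))`.
Proof: `ct_cells_nonneg` (the decomposition `CT = μ(a≁b)·[two-set row] + R2 + Cov·Cov`) with the rows of `r2_path`, the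
two-set row `setTwoClusterExchange` for (`a~c` ↑ in `C_a`, `b~y` ↑ in `C_b`) given `a≁b`, and Harris for `(a~b,a~c)`, `(a~b,b~y)`.
Previously known only through a 13 367-term machine certificate (prim-facecert gen 9, kit j143015). [this work] -/
theorem covTriangle_path : (prodBernoulli w).real (openConn a b)ᶜ ^ 2 *
        ((prodBernoulli w).real (openConn a c ∩ openConn b y) - (prodBernoulli w).real (openConn a c) * (prodBernoulli w).real (openConn b y)) ≤
      (prodBernoulli w).real ((openConn a b)ᶜ ∩ (openConn b y)ᶜ) *
        ((prodBernoulli w).real (openConn a b ∩ openConn a c) - (prodBernoulli w).real (openConn a b) * (prodBernoulli w).real (openConn a c)) +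
      (prodBernoulli w).real ((openConn a b)ᶜ ∩ (openConn a c)ᶜ) *
        ((prodBernoulli w).real (openConn a b ∩ openConn b y) - (prodBernoulli w).real (openConn a b) * (prodBernoulli w).real (openConn b y)) := by
  have hDabcy := isLowerSet_Dabcy (V := V) a b c y
  have hDaby : IsLowerSet ((openConn a b)ᶜ ∩ (openConn a y)ᶜ : Set (BondConfig V)) := (isUpperSet_openConn a b).compl.inter (isUpperSet_openConn a y).compl
  have hDab : IsLowerSet ((openConn a b)ᶜ : Set (BondConfig V)) := (isUpperSet_openConn a b).compl
  have hH1 : 0 ≤ (cell w a b c y 0 + cell w a b c y 1) * 1 - (cell w a b c y 0 + cell w a b c y 1 + cell w a b c y 6 + cell w a b c y 11) * (cell w a b c y 0 + cell w a b c y 1 + cell w a b c y 2 + cell w a b c y 3 + cell w a b c y 5 + cell w a b c y 7 + cell w a b c y 9) := by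
    have h := prodBernoulli_harris_lower w hDabcy hDaby MeasurableSet.of_discrete MeasurableSet.of_discrete
    rw [SwitchRelax.GR3.rE1, FourPointAtoms.real_xDabDay, real_Dabcy_Daby] at h
    linarith [h]
  have hH2 : 0 ≤ (cell w a b c y 0 + cell w a b c y 1) * 1 - (cell w a b c y 0 + cell w a b c y 1 + cell w a b c y 6 + cell w a b c y 11) * (cell w a b c y 0 + cell w a b c y 1 + cell w a b c y 2 + cell w a b c y 3 + cell w a b c y 4 + cell w a b c y 5 + cell w a b c y 7 + cell w a b c y 8 + cell w a b c y 9 + cell w a b c y 10) := by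
    have h := prodBernoulli_harris_lower w hDabcy hDab MeasurableSet.of_discrete MeasurableSet.of_discrete
    rw [SwitchRelax.GR3.rE1, real_Dab, real_Dabcy_Dab] at h
    linarith [h]
  have hT1 : 0 ≤ cell w a b c y 13 * (cell w a b c y 0 + cell w a b c y 1 + cell w a b c y 2 + cell w a b c y 3 + cell w a b c y 5 + cell w a b c y 6 + cell w a b c y 7 + cell w a b c y 9 + cell w a b c y 11 + cell w a b c y 13) - (cell w a b c y 6 + cell w a b c y 11 + cell w a b c y 13) * (cell w a b c y 5 + cell w a b c y 9 + cell w a b c y 13) := by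
    have h := setTwoClusterExchange w ({a} : Set V) ({y} : Set V) (A₁ := openConn a b) (A₂ := openConn a c)
      (B₁ := Set.univ) (B₂ := Set.univ)
      (TwoSetExchange.typePlus_openConn_of_mem _ _ (Set.mem_singleton a) b)
      (TwoSetExchange.typePlus_openConn_of_mem _ _ (Set.mem_singleton a) c)
      (fun _ _ _ _ _ => Set.mem_univ _) (fun _ _ _ _ _ => Set.mem_univ _)
    rw [dset_eq] at h
    simp only [Set.inter_univ] at h
    rw [real_Day_ab, real_Day_ac, real_Day_abac, real_Day] at h
    linarith [h]
  have hT2 : 0 ≤ (cell w a b c y 2 + cell w a b c y 7) * (cell w a b c y 0 + cell w a b c y 1 + cell w a b c y 2 + cell w a b c y 3 + cell w a b c y 4 + cell w a b c y 5 + cell w a b c y 7 + cell w a b c y 8 + cell w a b c y 9 + cell w a b c y 10) - (cell w a b c y 0 + cell w a b c y 1 + cell w a b c y 2 + cell w a b c y 3 + cell w a b c y 4 + cell w a b c y 7 + cell w a b c y 8) * (cell w a b c y 2 + cell w a b c y 7 + cell w a b c y 9) := by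
    have h := setTwoClusterExchange w ({a} : Set V) ({b} : Set V) (A₁ := Set.univ) (A₂ := Set.univ)
      (B₁ := (openConn a c)ᶜ) (B₂ := openConn b y)
      (fun _ _ _ _ _ => Set.mem_univ _) (fun _ _ _ _ _ => Set.mem_univ _)
      (TwoSetExchange.typeMinus_not_openConn_of_mem _ _ (Set.mem_singleton a) c)
      (TwoSetExchange.typeMinus_openConn_of_mem _ _ (Set.mem_singleton b) y)
    rw [dset_eq] at h
    simp only [Set.univ_inter, Set.inter_univ] at h
    rw [FourPointAtoms.real_shk_AB, real_Dab_by, real_Dab, real_Dab_nacby] at h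
    linarith [h]
  have hAGabc : 0 ≤ (cell w a b c y 13 + cell w a b c y 14) * (cell w a b c y 0 + cell w a b c y 1 + cell w a b c y 2 + cell w a b c y 4) - (cell w a b c y 6 + cell w a b c y 11 + cell w a b c y 12) * (cell w a b c y 5 + cell w a b c y 9 + cell w a b c y 10) - (cell w a b c y 6 + cell w a b c y 11 + cell w a b c y 12) * (cell w a b c y 3 + cell w a b c y 7 + cell w a b c y 8) - (cell w a b c y 5 + cell w a b c y 9 + cell w a b c y 10) * (cell w a b c y 3 + cell w a b c y 7 + cell w a b c y 8) := by
    have h := prodBernoulli_threePoint_strongHarris w a b c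
    rw [FourPointAtoms.real_lu1, FourPointAtoms.real_lu2, FourPointAtoms.real_lu3, FourPointAtoms.real_lt, FourPointAtoms.real_shk_ABC] at h
    linarith [h]
  have hAGaby : 0 ≤ (cell w a b c y 12 + cell w a b c y 14) * (cell w a b c y 0 + cell w a b c y 1 + cell w a b c y 3 + cell w a b c y 5) - (cell w a b c y 6 + cell w a b c y 11 + cell w a b c y 13) * (cell w a b c y 4 + cell w a b c y 8 + cell w a b c y 10) - (cell w a b c y 6 + cell w a b c y 11 + cell w a b c y 13) * (cell w a b c y 2 + cell w a b c y 7 + cell w a b c y 9) - (cell w a b c y 4 + cell w a b c y 8 + cell w a b c y 10) * (cell w a b c y 2 + cell w a b c y 7 + cell w a b c y 9) := by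
    have h := prodBernoulli_threePoint_strongHarris w a b y
    rw [FourPointAtoms.real_xCabDay, FourPointAtoms.real_xCayDab, FourPointAtoms.real_xCbyDab, FourPointAtoms.real_xCabCay, FourPointAtoms.real_xDabDayDby] at h
    linarith [h]
  have hHUA : 0 ≤ (cell w a b c y 13 + cell w a b c y 14) * 1 - (cell w a b c y 6 + cell w a b c y 11 + cell w a b c y 12 + cell w a b c y 13 + cell w a b c y 14) * (cell w a b c y 5 + cell w a b c y 9 + cell w a b c y 10 + cell w a b c y 13 + cell w a b c y 14) := by
    have h := prodBernoulli_harris w (isUpperSet_openConn a b) (isUpperSet_openConn a c) MeasurableSet.of_discrete MeasurableSet.of_discrete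
    rw [SwitchRelax.Finc24.rE2, SwitchRelax.E1inc.rE1_E1inc, FourPointAtoms.real_lt] at h
    linarith [h]
  have hHUB : 0 ≤ (cell w a b c y 12 + cell w a b c y 14) * 1 - (cell w a b c y 6 + cell w a b c y 11 + cell w a b c y 12 + cell w a b c y 13 + cell w a b c y 14) * (cell w a b c y 2 + cell w a b c y 7 + cell w a b c y 9 + cell w a b c y 12 + cell w a b c y 14) := by
    have h := prodBernoulli_harris w (isUpperSet_openConn a b) (isUpperSet_openConn b y) MeasurableSet.of_discrete MeasurableSet.of_discrete
    rw [SwitchRelax.Finc24.rE2, SwitchRelax.IncDict.d22, SwitchRelax.IncDict.d55] at h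
    linarith [h]
  have key := ct_cells_nonneg (cell w a b c y 0) (cell w a b c y 1) (cell w a b c y 2) (cell w a b c y 3) (cell w a b c y 4) (cell w a b c y 5) (cell w a b c y 6) (cell w a b c y 7) (cell w a b c y 8) (cell w a b c y 9) (cell w a b c y 10) (cell w a b c y 11) (cell w a b c y 12) (cell w a b c y 13) (cell w a b c y 14)
    (cell_nonneg w a b c y 0) (cell_nonneg w a b c y 1) (cell_nonneg w a b c y 2) (cell_nonneg w a b c y 3) (cell_nonneg w a b c y 4) (cell_nonneg w a b c y 5) (cell_nonneg w a b c y 6) (cell_nonneg w a b c y 7) (cell_nonneg w a b c y 8) (cell_nonneg w a b c y 9) (cell_nonneg w a b c y 10) (cell_nonneg w a b c y 11) (cell_nonneg w a b c y 12) (cell_nonneg w a b c y 13) (cell_nonneg w a b c y 14) (sum_cell_eq_one w a b c y) hH1 hH2 hT1 hT2 hAGabc hAGaby hHUA hHUB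
  rw [real_Dab, SwitchRelax.IncDict.d54, SwitchRelax.E1inc.rE1_E1inc, SwitchRelax.IncDict.d22, FourPointAtoms.real_xDabDby, FourPointAtoms.real_lt, SwitchRelax.Finc24.rE2, FourPointAtoms.real_shk_AB, SwitchRelax.IncDict.d55]
  linarith [key]

end CovTrianglePath

end Summit.CriticalPhenomena.PercolationContinuityZ3.Theorems
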